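import Literature.NumberTheory.Automorphic.GelbartJacquetAdjointLiftArchimedean
import Literature.NumberTheory.Automorphic.GelbartJacquetSymmSquareProofs
import Literature.NumberTheory.Automorphic.ArchParameterUnique
import HarnessLib

/-!
# Gelbart–Jacquet's adjoint lift `GL₂ → GL₃`, archimedean clause: the algebra of `Ad` on
# Harish-Chandra parameters and infinity types, and Thm. (9.3) at `∞` in the form in which it is used

Sibling proof file (theorems only; no `sorry`, no named fact, no definition) of
`Literature.NumberTheory.Automorphic.GelbartJacquetAdjointLiftArchimedean`, whose named fact
`GelbartJacquet_adjoint_lift_archimedean` renders S. Gelbart, H. Jacquet, *A relation between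
automorphic representations of `GL(2)` and `GL(3)`*, Ann. Sci. ÉNS (4) **11** (1978) 471–542
[GelbartJacquet1978], Thm. (9.3) (2)–(3) (p. 534: "*Let `σ` be a unitary irreducible representation
of `G₂(𝔸)` which is automorphic cuspidal. Assume that for any character `χ` of `F^× \ 𝔸^×`, `χ ≠ 1`,
the representations `σ` and `σ ⊗ χ` are inequivalent. Then … (2) for any place `v` the
representation `σ_v` admits a lift `π_v` to `G_{3,v}`; (3) set `π = ⊗ π_v` (all `v`). Then `π` is
automorphic cuspidal*") together with the archimedean local lift of Prop. 3.2 with (3.2.1)–(3.2.3)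
(pp. 485–486: for `F` archimedean and `σ = π(τ)`, `deg τ = 2`, "`τ ⊗ τ̃ = λ ⊕ 1`, where
`deg λ = 3`. Set `π = π(λ)`"), rendered on Harish-Chandra parameters: if `π` on `GL₂(𝔸_F)` has
archimedean parameter `χ` (the multiset of `z`-exponents at each complex embedding `σ`), the lift has
archimedean parameter `σ ↦ Ad₊ (χ σ)`, where `Ad₊ χ = {a - b : (a, b) ∈ χ × χ}` with one copy of `0`
removed — the term `((χ ×ˢ χ).map fun p => p.1 - p.2).erase 0` of the fact, written out in full
in every statement below and abbreviated `Ad₊ χ` in the prose only.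

## What is proved here

* **The algebra of `Ad₊`.** The pair formula `Ad₊ {a, b} = {a - b, b - a, 0}` (`adArch_pair`:
  the `z`-exponents of `λ = Ad ∘ τ` when `τ|_{ℂ^×} = z^a ⊕ z^b`, (3.2.2)–(3.2.3)); membership and
  cardinality (`card χ · card χ - 1`, i.e. `3` for `GL₂`); `∑ Ad₊ χ = 0` (`sum_adArch`: the lift has
  trivial central quasi-character, Def. 3.1.3 (i), `det λ = 1`, (3.2.5)); symmetry under negation
  (`map_neg_adArch`: the lift is self-dual, Def. 3.1.3 (ii), `λ̃ = λ`, (3.2.6)); twist invariance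
  `Ad₊ (χ + s) = Ad₊ χ` (`adArch_map_add_const`: "if `π` is a lift of `σ`, it is also a lift of
  `σ ⊗ χ` for any `χ`", p. 485 — the unitarity normalisation remark of the fact's docstring);
  integrality (`adArch_integral`: differences of exponents lying in one coset `s + ℤ` are integers)
  and regularity (`nodup_adArch_pair`: `a ≠ b ⇒ {a - b, b - a, 0}` has no repetition).
* `InfinityType.exists_ad` — **the adjoint of an infinity type for `GL₂`**: a well-formed
  `T : InfinityType K 2` has a well-formed adjoint `T₃ : InfinityType K 3` (weights
  `(a_p - a_q, b_p - b_q)` over pairs of weights, one diagonal weight `(0, 0)` removed) whose `a`- and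
  `b`-multisets are `Ad₊` of those of `T`; it is L-algebraic **and** C-algebraic as soon as `T` is
  L-algebraic or C-algebraic (for `GL₃`, `(n - 1)/2 = 1 ∈ ℤ`), and regular when `T` is regular
  (Buzzard–Gee 2014, §3.1; Clozel 1990, Déf. 1.8, 3.12).
* `AutomorphicRepData.isLAlgebraic_of_hasArchParameter_ad`,
  `AutomorphicRepData.isRegularAlgebraic_of_hasArchParameter_ad` — an automorphic `P` on `GL₃` whose
  archimedean parameter is `Ad₊` of that of `π` on `GL₂` (the archimedean clause of the fact) is
  L- and C-algebraic when `π` is L- or C-algebraic, and regular algebraic when `π` is; and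
  `AutomorphicRepData.infinityType_map_a_eq_ad` — every infinity type of such a `P` has `a`-multisets
  `Ad₊` of those of `π` (uniqueness of archimedean parameters, `hasArchParameter_unique`, a theorem of
  the tree).
* **Projections.** `GelbartJacquet_adjoint_lift_archimedean.adjoint_lift`: the fact contains verbatim
  the tree's Satake-only fact `GelbartJacquet_adjoint_lift` (`LanglandsTetrahedral`; Gelbart 1997,
  Thm. 5.3.2); `GelbartJacquet_adjoint_lift_archimedean.symmSq_cuspidal`: hence also
  `GelbartJacquet_symmSq_cuspidal` (`GelbartJacquet_symmSq_cuspidal_of_adjoint_lift`).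
* **Thm. (9.3) at `∞` in the form in which it is used** (the relocating Summits file
  `Summit.Langlands.Langlands.Theorems.ResidualAutomorphyOdd…Facts`: a weight-`k` newform,
  `{(k-1)/2, (1-k)/2} ↦ {k - 1, 1 - k, 0}`): `GelbartJacquet_adjoint_lift_archimedean.exists_lift_pair`
  (archimedean parameter `σ ↦ {a σ, b σ}` gives a cuspidal lift with parameter
  `σ ↦ {a σ - b σ, b σ - a σ, 0}`) and
  `GelbartJacquet_adjoint_lift_archimedean.exists_lift_isRegularAlgebraic` (a regular algebraic `π`
  has a regular algebraic, L-algebraic cuspidal lift).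

## Status of the discharge `GelbartJacquet_adjoint_lift_archimedean_holds` (triage: XL)

The fact asserts, for every number field `F` and every cuspidal Borel–Jacquet datum `π` on
`GL₂(𝔸_F)` without a.e. quadratic self-twist, the **existence of a cuspidal datum `P` on
`GL₃(𝔸_F)`** (`CuspidalAutomorphicRepData 3 F _`: an irreducible admissible subquotient of the space
of cusp forms) with prescribed Satake parameters a.e. and prescribed Harish-Chandra parameters. It
contains verbatim the tree's `GelbartJacquet_adjoint_lift` (projection `.adjoint_lift` below), itself
undischarged, and nothing weaker than the printed theorem produces such a `P`. The printed proof
(§9, pp. 534–541) is: (a) the local lifts `σ_v ↦ π_v` (§3: Prop. 3.2 archimedean, through the local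
Langlands correspondence `τ ↦ π(τ)` for `GL₂(ℝ), GL₂(ℂ), GL₃(ℝ), GL₃(ℂ)`; Prop. 3.3
non-archimedean, non-extraordinary; (9.4) extraordinary, by a global argument), characterised by
`L(s, π ⊗ χ) = L(s, (σ ⊗ χ) × σ̃)/L(s, χ)` and the matching `ε`-factors (Def. 3.1.3) — this needs
the local Rankin–Selberg factors of Jacquet, *Automorphic forms on `GL(2)` II* (LNM 278) and the local
theory of Jacquet–Piatetski-Shapiro–Shalika, *Automorphic forms on `GL(3)`*, Ann. of Math. 109 (1979);
(b) the analytic continuation, functional equation and — under `σ ≇ σ ⊗ χ` — entireness and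
boundedness in vertical strips of `L₂(s, σ, χ) = L(s, (σ ⊗ χ) × σ̃)/L(s, χ)` (§4–§8: Shimura's method,
an integral of `φ_σ` against a theta series and an Eisenstein series on `GL₂`, with the Weil
representation of §5–§7); (c) the converse theorem for `GL₃` (JPSS 1979, Thm. 13.6) applied to
`π = ⊗ π_v`, and cuspidality from the absence of poles (9.5)–(9.8). None of (a)–(c) has a carrier on
the present tree: the Borel–Jacquet model extracts no local component `π_v` of a datum (module
docstring of `AutomorphicRepsGL`), and there are no Whittaker models, no local or global Rankin–Selberg
integrals, no Weil representation and no converse theorem. The discharge is therefore parked on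
`GelbartJacquet_adjoint_lift` (the same theorem without its archimedean clause; any formalisation of
Thm. (9.3) (2)–(3) constructs `P = ⊗_v π_v` with `π_∞` the lift of Prop. 3.2, whose Harish-Chandra
parameter is `adArch_pair` by the compatibility of `τ ↦ π(τ)` with infinitesimal characters, Knapp,
*Local Langlands correspondence: the archimedean case*, Motives II (1994), §2–§3). Nothing in this file
assumes the fact except the consequences named `GelbartJacquet_adjoint_lift_archimedean.*`, which take
it as the hypothesis `h`.

## References

* [GelbartJacquet1978] S. Gelbart, H. Jacquet, *A relation between automorphic representations of
  `GL(2)` and `GL(3)`*, Ann. Sci. ÉNS (4) 11 (1978), 471–542: Def. 3.1.3 and Prop. 3.2 with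
  (3.2.1)–(3.2.6) (pp. 485–486), (3.5) (p. 490), (3.7) (p. 491), Thm. (9.3) (p. 534),
  Remark (9.9) (p. 541).
* [Gelbart1997] S. Gelbart, *Three lectures on the modularity of `ρ̄_{E,3}` and the Langlands
  reciprocity conjecture*, in Modular Forms and Fermat's Last Theorem (1997), Thm. 5.3.2.
* [BuzzardGee2014] K. Buzzard, T. Gee, *The conjectural connections between automorphic
  representations and Galois representations* (2014), §3.1.
* [Clozel1990] L. Clozel, *Motifs et formes automorphes* (1990), Déf. 1.8, §3.3, Déf. 3.12.
-/

noncomputable section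

open scoped Classical MatrixGroups
open IsDedekindDomain NumberField

namespace Literature.NumberTheory.Automorphic


/-! ### Two multiset lemmas -/

/-- The product of two mapped multisets is the mapped product:
`(s.map f) ×ˢ (t.map g) = (s ×ˢ t).map (Prod.map f g)`. [folklore] -/
theorem map_sprod_map {α β γ δ : Type*} (f : α → γ) (g : β → δ) (s : Multiset α)
    (t : Multiset β) : (s.map f) ×ˢ (t.map g) = (s ×ˢ t).map (Prod.map f g) := by
  induction s using Multiset.induction_on with
  | empty => simp
  | cons a s ih => simp [ih, Multiset.map_map]

/-- The raw differences `{p.1 - p.2 : p ∈ χ × χ}` are stable under negation (negation is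
precomposition with the swap of the two factors). [folklore] -/
theorem map_neg_map_sub_product (χ : Multiset ℂ) :
    ((χ ×ˢ χ).map fun p : ℂ × ℂ => p.1 - p.2).map Neg.neg =
      (χ ×ˢ χ).map fun p : ℂ × ℂ => p.1 - p.2 := by
  conv_rhs => rw [← Multiset.map_swap_product χ χ]
  simp only [Multiset.map_map, Function.comp_def, Prod.fst_swap, Prod.snd_swap, neg_sub]

/-- The raw differences `{p.1 - p.2 : p ∈ χ × χ}` sum to zero. [folklore] -/
theorem sum_map_sub_product (χ : Multiset ℂ) :
    ((χ ×ˢ χ).map fun p : ℂ × ℂ => p.1 - p.2).sum = 0 := by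
  have h := congrArg Multiset.sum (map_neg_map_sub_product χ)
  rw [Multiset.sum_map_neg'] at h
  linear_combination -h / 2

/-- `0` is one of the raw differences as soon as `χ ≠ 0` (the diagonal `(a, a)`). [folklore] -/
theorem zero_mem_map_sub_product {χ : Multiset ℂ} (hχ : χ ≠ 0) :
    (0 : ℂ) ∈ (χ ×ˢ χ).map fun p : ℂ × ℂ => p.1 - p.2 := by
  obtain ⟨a, ha⟩ := Multiset.exists_mem_of_ne_zero hχ
  exact Multiset.mem_map.mpr ⟨(a, a), Multiset.mem_product.mpr ⟨ha, ha⟩, sub_self a⟩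

/-- Twisting every exponent by `s` does not change the raw differences. [folklore] -/
theorem map_sub_product_map_add (χ : Multiset ℂ) (s : ℂ) :
    (((χ.map (· + s)) ×ˢ (χ.map (· + s))).map fun p : ℂ × ℂ => p.1 - p.2) =
      (χ ×ˢ χ).map fun p : ℂ × ℂ => p.1 - p.2 := by
  rw [map_sprod_map, Multiset.map_map]
  exact Multiset.map_congr rfl fun p _ => by simp

/-! ### The algebra of the additive adjoint `Ad₊` (Gelbart–Jacquet 1978, §3.2) -/

/-- **Pair formula** (Gelbart–Jacquet 1978, Prop. 3.2, (3.2.1)–(3.2.3): for `σ = π(τ)`,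
`deg τ = 2`, "`τ ⊗ τ̃ = λ ⊕ 1`, where `deg λ = 3`. Set `π = π(λ)`"): if `τ|_{ℂ^×} = z^a ⊕ z^b` at an
embedding, the `z`-exponents of `λ = Ad ∘ τ` there are `Ad₊ {a, b} = {a - b, b - a, 0}` (the four
exponents `0, a - b, b - a, 0` of `τ ⊗ τ̃` less one `0` for the trivial summand).
[cite: GelbartJacquet1978, Prop. 3.2, (3.2.1)–(3.2.3)] -/
theorem adArch_pair (a b : ℂ) :
    ((({a, b} : Multiset ℂ) ×ˢ ({a, b} : Multiset ℂ)).map fun p : ℂ × ℂ => p.1 - p.2).erase 0 =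
      {a - b, b - a, 0} := by
  simp [Multiset.insert_eq_cons, Multiset.cons_product]
  rw [Multiset.cons_swap (a - b) 0, Multiset.erase_cons_head]

/-- Membership in `Ad₊ χ`: its elements are differences of two exponents of `χ`. [folklore] -/
theorem exists_of_mem_adArch {χ : Multiset ℂ} {c : ℂ}
    (hc : c ∈ ((χ ×ˢ χ).map fun p : ℂ × ℂ => p.1 - p.2).erase 0) :
    ∃ a ∈ χ, ∃ b ∈ χ, a - b = c := by
  obtain ⟨p, hp, rfl⟩ := Multiset.mem_map.mp (Multiset.mem_of_mem_erase hc)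
  obtain ⟨ha, hb⟩ := Multiset.mem_product.mp hp
  exact ⟨p.1, ha, p.2, hb, rfl⟩

/-- **Cardinality**: `card (Ad₊ χ) = card χ · card χ - 1` for `χ ≠ 0` (`Ad : GL_n → GL_{n² - 1}`).
[folklore] -/
theorem card_adArch {χ : Multiset ℂ} (hχ : χ ≠ 0) :
    Multiset.card (((χ ×ˢ χ).map fun p : ℂ × ℂ => p.1 - p.2).erase 0) =
      Multiset.card χ * Multiset.card χ - 1 := by
  rw [Multiset.card_erase_of_mem (zero_mem_map_sub_product hχ), Multiset.card_map,
    Multiset.card_product, Nat.pred_eq_sub_one]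

/-- For a `GL₂` parameter (`card χ = 2`) the adjoint parameter has three entries (`GL₃`).
[cite: GelbartJacquet1978, (3.2.2)] -/
theorem card_adArch_of_card_eq_two {χ : Multiset ℂ} (hχ : Multiset.card χ = 2) :
    Multiset.card (((χ ×ˢ χ).map fun p : ℂ × ℂ => p.1 - p.2).erase 0) = 3 := by
  have h0 : χ ≠ 0 := by
    rintro rfl
    simp at hχ
  rw [card_adArch h0, hχ]

/-- **Central character rule**: `∑ Ad₊ χ = 0` — at `∞` the lift has trivial central
quasi-character (Gelbart–Jacquet 1978, Def. 3.1.3 (i); `det (τ ⊗ τ̃) = 1`, hence `det λ = 1`,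
(3.2.5)). [cite: GelbartJacquet1978, Def. 3.1.3 (i) and (3.2.5)] -/
theorem sum_adArch (χ : Multiset ℂ) :
    Multiset.sum (((χ ×ˢ χ).map fun p : ℂ × ℂ => p.1 - p.2).erase 0) = 0 := by
  by_cases h : (0 : ℂ) ∈ (χ ×ˢ χ).map fun p : ℂ × ℂ => p.1 - p.2
  · have h' := Multiset.sum_erase h
    rw [zero_add, sum_map_sub_product] at h'
    exact h'
  · rw [Multiset.erase_of_notMem h, sum_map_sub_product]

/-- **Self-duality rule**: `Ad₊ χ` is stable under negation — the lift is self-contragredient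
(Gelbart–Jacquet 1978, Def. 3.1.3 (ii) "`π̃ ≅ π`"; `λ̃ = λ`, (3.2.6)); on exponents the contragredient
negates. [cite: GelbartJacquet1978, Def. 3.1.3 (ii) and (3.2.6)] -/
theorem map_neg_adArch (χ : Multiset ℂ) :
    Multiset.map Neg.neg (((χ ×ˢ χ).map fun p : ℂ × ℂ => p.1 - p.2).erase 0) =
      ((χ ×ˢ χ).map fun p : ℂ × ℂ => p.1 - p.2).erase 0 := by
  rw [Multiset.map_erase _ neg_injective, neg_zero, map_neg_map_sub_product]

/-- **Twisting rule**: `Ad₊ (χ + s) = Ad₊ χ` — shifting every exponent by `s` (the archimedean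
parameter of `σ ⊗ |det|^s`) does not change the adjoint parameter ("if `π` is a lift of `σ`, it is
also a lift of `σ ⊗ χ` for any `χ`", Gelbart–Jacquet 1978, p. 485, after Def. 3.1.3); this is the
passage between the unitary `σ` of Thm. (9.3) and an arbitrary cuspidal datum recorded in the fact's
docstring. [cite: GelbartJacquet1978, §3.1, p. 485] -/
theorem adArch_map_add_const (χ : Multiset ℂ) (s : ℂ) :
    (((χ.map (· + s)) ×ˢ (χ.map (· + s))).map fun p : ℂ × ℂ => p.1 - p.2).erase 0 =
      ((χ ×ˢ χ).map fun p : ℂ × ℂ => p.1 - p.2).erase 0 := by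
  rw [map_sub_product_map_add]

/-- **Integrality rule**: if all exponents of `χ` lie in one coset `s + ℤ` (e.g. `χ` L-algebraic,
`s = 0`, or C-algebraic, `s = (n-1)/2`), every exponent of `Ad₊ χ` is an integer.
Buzzard–Gee 2014, §3.1. [cite: BuzzardGee2014, §3.1] -/
theorem adArch_integral {χ : Multiset ℂ} {s : ℂ} (h : ∀ a ∈ χ, ∃ k : ℤ, a = k + s) :
    ∀ c ∈ ((χ ×ˢ χ).map fun p : ℂ × ℂ => p.1 - p.2).erase 0, ∃ k : ℤ, c = k := by
  intro c hc
  obtain ⟨a, ha, b, hb, rfl⟩ := exists_of_mem_adArch hc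
  obtain ⟨k, hk⟩ := h a ha
  obtain ⟨l, hl⟩ := h b hb
  exact ⟨k - l, by rw [hk, hl]; push_cast; ring⟩

/-- **Regularity rule**: for `a ≠ b` the adjoint parameter `Ad₊ {a, b} = {a - b, b - a, 0}` has no
repeated entry (characteristic `0`: `a - b ≠ b - a`). Clozel 1990, Déf. 3.12.
[cite: Clozel1990, Déf. 3.12] -/
theorem nodup_adArch_pair {a b : ℂ} (hab : a ≠ b) :
    Multiset.Nodup
      (((({a, b} : Multiset ℂ) ×ˢ ({a, b} : Multiset ℂ)).map fun p : ℂ × ℂ => p.1 - p.2).erase 0) := by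
  rw [adArch_pair]
  have h₁ : a - b ≠ 0 := sub_ne_zero.mpr hab
  have h₂ : b - a ≠ 0 := sub_ne_zero.mpr hab.symm
  have h₃ : a - b ≠ b - a := fun h => h₁ (by linear_combination h / 2)
  simp [h₁, h₂, h₃]

/-! ### The adjoint of an infinity type for `GL₂` -/

/-- **The adjoint of an infinity type.** A well-formed infinity type `T` for `GL₂` over `K`
(two weights `(a_i, b_i)_σ` at each embedding, `T σ̄ = swap (T σ)`) has a well-formed adjoint `T₃`
for `GL₃`: at each `σ` the weights `(a_p - a_q, b_p - b_q)` over the pairs `(p, q)` of weights of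
`T σ`, with one diagonal weight `(0, 0)` removed — the restriction to `ℂ^×` of `λ = Ad ∘ τ`,
`τ ⊗ τ̃ = λ ⊕ 1` (Gelbart–Jacquet 1978, (3.2.2)), the characters `z^{a_p} z̄^{b_p} · z^{-a_q} z̄^{-b_q}`.
Its `a`- and `b`-multisets are `Ad₊` of those of `T`; it is L-algebraic and C-algebraic as soon as
`T` is L-algebraic or C-algebraic (differences within one coset of `ℤ` are integers, and for `GL₃`
the C-algebraic shift `(n-1)/2 = 1` is an integer), and regular when `T` is regular
(`a₁ ≠ a₂ ⇒ {a₁ - a₂, a₂ - a₁, 0}` has no repetition). Buzzard–Gee 2014, §3.1; Clozel 1990,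
Déf. 1.8 and 3.12. [cite: BuzzardGee2014, §3.1] [cite: GelbartJacquet1978, (3.2.2)] -/
theorem InfinityType.exists_ad {K : Type*} [Field K] (T : InfinityType K 2) (hT : T.IsWellFormed) :
    ∃ T₃ : InfinityType K 3, T₃.IsWellFormed ∧
      (∀ σ, (T₃ σ).map ArchWeight.a =
        ((((T σ).map ArchWeight.a) ×ˢ ((T σ).map ArchWeight.a)).map
          fun p : ℂ × ℂ => p.1 - p.2).erase 0) ∧
      (∀ σ, (T₃ σ).map ArchWeight.b =
        ((((T σ).map ArchWeight.b) ×ˢ ((T σ).map ArchWeight.b)).map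
          fun p : ℂ × ℂ => p.1 - p.2).erase 0) ∧
      (T.IsLAlgebraic ∨ T.IsCAlgebraic → T₃.IsLAlgebraic ∧ T₃.IsCAlgebraic) ∧
      (T.IsRegular → T₃.IsRegular) := by
  -- the weight `(a_p - a_q, b_p - b_q)` of a pair of weights, kept opaque: only its two projections
  -- are used below
  obtain ⟨w, hwa, hwb⟩ : ∃ w : ArchWeight × ArchWeight → ArchWeight,
      (∀ pq, (w pq).a = pq.1.a - pq.2.a) ∧ ∀ pq, (w pq).b = pq.1.b - pq.2.b :=
    ⟨fun pq => ⟨pq.1.a - pq.2.a, pq.1.b - pq.2.b, by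
        obtain ⟨k, hk⟩ := pq.1.exists_int_sub
        obtain ⟨l, hl⟩ := pq.2.exists_int_sub
        exact ⟨k - l, by push_cast; linear_combination hk - hl⟩⟩,
      fun _ => rfl, fun _ => rfl⟩
  have hwa₂ : ∀ p q : ArchWeight, (w (p, q)).a = p.a - q.a := fun p q => hwa (p, q)
  have hwb₂ : ∀ p q : ArchWeight, (w (p, q)).b = p.b - q.b := fun p q => hwb (p, q)
  -- the zero weight `(0, 0)`: the trivial summand removed from `τ ⊗ τ̃ = λ ⊕ 1`
  obtain ⟨z, hza, hzb⟩ : ∃ z : ArchWeight, z.a = 0 ∧ z.b = 0 := ⟨⟨0, 0, 0, by simp⟩, rfl, rfl⟩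
  have hzswap : z.swap = z := ArchWeight.ext (by simp [hza, hzb]) (by simp [hza, hzb])
  have hswap : Function.Injective ArchWeight.swap := fun p q h => by
    simpa using congrArg ArchWeight.swap h
  have hdiag : ∀ p : ArchWeight, w (p, p) = z := fun p =>
    ArchWeight.ext (by rw [hwa₂, hza, sub_self]) (by rw [hwb₂, hzb, sub_self])
  -- the adjoint infinity type: all pairs of weights, one diagonal weight removed
  obtain ⟨T₃, hT₃⟩ : ∃ T₃ : InfinityType K 3, ∀ σ, T₃ σ = (((T σ) ×ˢ (T σ)).map w).erase z :=
    ⟨fun σ => (((T σ) ×ˢ (T σ)).map w).erase z, fun _ => rfl⟩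
  have hne : ∀ σ, T σ ≠ 0 := fun σ h => by
    have hcard := hT.1 σ
    rw [h] at hcard
    simp at hcard
  have hzmem : ∀ σ, z ∈ ((T σ) ×ˢ (T σ)).map w := fun σ => by
    obtain ⟨p, hp⟩ := Multiset.exists_mem_of_ne_zero (hne σ)
    exact Multiset.mem_map.mpr ⟨(p, p), Multiset.mem_product.mpr ⟨hp, hp⟩, hdiag p⟩
  -- the two projections of the multiset of all pairs are the raw differences
  have hSa : ∀ σ, (((T σ) ×ˢ (T σ)).map w).map ArchWeight.a =
      (((T σ).map ArchWeight.a) ×ˢ ((T σ).map ArchWeight.a)).map fun p : ℂ × ℂ => p.1 - p.2 :=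
    fun σ => by
      rw [map_sprod_map, Multiset.map_map, Multiset.map_map]
      exact Multiset.map_congr rfl fun pq _ => by simp [hwa]
  have hSb : ∀ σ, (((T σ) ×ˢ (T σ)).map w).map ArchWeight.b =
      (((T σ).map ArchWeight.b) ×ˢ ((T σ).map ArchWeight.b)).map fun p : ℂ × ℂ => p.1 - p.2 :=
    fun σ => by
      rw [map_sprod_map, Multiset.map_map, Multiset.map_map]
      exact Multiset.map_congr rfl fun pq _ => by simp [hwb]
  have ha : ∀ σ, (T₃ σ).map ArchWeight.a =
      ((((T σ).map ArchWeight.a) ×ˢ ((T σ).map ArchWeight.a)).map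
        fun p : ℂ × ℂ => p.1 - p.2).erase 0 := fun σ => by
    rw [hT₃, Multiset.map_erase_of_mem _ _ (hzmem σ), hza, hSa]
  have hb : ∀ σ, (T₃ σ).map ArchWeight.b =
      ((((T σ).map ArchWeight.b) ×ˢ ((T σ).map ArchWeight.b)).map
        fun p : ℂ × ℂ => p.1 - p.2).erase 0 := fun σ => by
    rw [hT₃, Multiset.map_erase_of_mem _ _ (hzmem σ), hzb, hSb]
  -- membership in `T₃ σ`: pairs of weights of `T σ`
  have hmem : ∀ σ r, r ∈ T₃ σ → ∃ p ∈ T σ, ∃ q ∈ T σ, r = w (p, q) := by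
    intro σ r hr
    rw [hT₃] at hr
    obtain ⟨pq, hpq, rfl⟩ := Multiset.mem_map.mp (Multiset.mem_of_mem_erase hr)
    obtain ⟨hp, hq⟩ := Multiset.mem_product.mp hpq
    exact ⟨pq.1, hp, pq.2, hq, rfl⟩
  refine ⟨T₃, ⟨fun σ => ?_, fun σ => ?_⟩, ha, hb, fun halg => ?_, fun hreg σ => ?_⟩
  · -- three weights at each embedding: `2 · 2 - 1`
    rw [hT₃, Multiset.card_erase_of_mem (hzmem σ), Multiset.card_map, Multiset.card_product, hT.1 σ]
    rfl
  · -- compatibility with complex conjugation: `w (p̄, q̄) = w (p, q)‾` and `z̄ = z`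
    rw [hT₃, hT₃, hT.2 σ, map_sprod_map, Multiset.map_map, Multiset.map_erase _ hswap, hzswap,
      Multiset.map_map]
    congr 1
    exact Multiset.map_congr rfl fun pq _ =>
      ArchWeight.ext (by simp [hwa, hwb]) (by simp [hwa, hwb])
  · -- L- or C-algebraic `T`: all exponents in one coset `c + ℤ`, so all differences are integers
    obtain ⟨c, hc⟩ : ∃ c : ℂ, ∀ σ, ∀ p ∈ T σ, ∃ k l : ℤ, p.a = k + c ∧ p.b = l + c := by
      rcases halg with h | h
      · refine ⟨0, fun σ p hp => ?_⟩
        obtain ⟨k, l, hk, hl⟩ := h σ p hp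
        exact ⟨k, l, by rw [hk, add_zero], by rw [hl, add_zero]⟩
      · exact ⟨_, h⟩
    have hint : ∀ σ, ∀ r ∈ T₃ σ, ∃ k l : ℤ, r.a = k ∧ r.b = l := by
      intro σ r hr
      obtain ⟨p, hp, q, hq, rfl⟩ := hmem σ r hr
      obtain ⟨k, l, hk, hl⟩ := hc σ p hp
      obtain ⟨k', l', hk', hl'⟩ := hc σ q hq
      refine ⟨k - k', l - l', ?_, ?_⟩
      · rw [hwa₂]; push_cast; linear_combination hk - hk'
      · rw [hwb₂]; push_cast; linear_combination hl - hl'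
    refine ⟨hint, fun σ r hr => ?_⟩
    obtain ⟨k, l, hk, hl⟩ := hint σ r hr
    exact ⟨k - 1, l - 1, by rw [hk]; push_cast; ring, by rw [hl]; push_cast; ring⟩
  · -- regular `T` (`a₁ ≠ a₂` at each embedding) gives a regular `T₃`
    rw [ha σ]
    obtain ⟨x, y, hxy⟩ := Multiset.card_eq_two.mp
      (show Multiset.card ((T σ).map ArchWeight.a) = 2 by rw [Multiset.card_map, hT.1 σ])
    have hreg' := hreg σ
    rw [hxy] at hreg' ⊢
    exact nodup_adArch_pair (by simpa using hreg')

/-! ### Automorphic representations whose archimedean parameter is an adjoint -/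

section Arch

variable {F : Type} [Field F] [NumberField F]
  {hF : isCompact_glFiniteIntegralLevel 2 F} {hF3 : isCompact_glFiniteIntegralLevel 3 F}
  {π : AutomorphicRepData (AutomorphyDatum.gl 2 F hF)}
  {P : AutomorphicRepData (AutomorphyDatum.gl 3 F hF3)}

/-- **The adjoint lift of an L- or C-algebraic `GL₂` representation is L-algebraic and
C-algebraic.** If the archimedean parameter of `P` on `GL₃(𝔸_F)` is `σ ↦ Ad₊ (χ σ)` whenever `π`
on `GL₂(𝔸_F)` has archimedean parameter `χ` (the archimedean clause of
`GelbartJacquet_adjoint_lift_archimedean`), and `π` is L-algebraic or C-algebraic, then `P` is both: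
its infinity type is the adjoint of an infinity type of `π` (`InfinityType.exists_ad`).
Buzzard–Gee 2014, §3.1; Gelbart–Jacquet 1978, Prop. 3.2. [cite: BuzzardGee2014, §3.1] -/
theorem AutomorphicRepData.isLAlgebraic_of_hasArchParameter_ad
    (hP : ∀ χ : (F →+* ℂ) → Multiset ℂ, π.HasArchParameter χ →
      P.HasArchParameter fun σ : F →+* ℂ =>
        (((χ σ) ×ˢ (χ σ)).map fun p : ℂ × ℂ => p.1 - p.2).erase 0)
    (hπ : π.IsLAlgebraic ∨ π.IsCAlgebraic) : P.IsLAlgebraic ∧ P.IsCAlgebraic := by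
  obtain ⟨T, hT, hTalg⟩ : ∃ T : InfinityType F 2, π.HasInfinityType T ∧
      (T.IsLAlgebraic ∨ T.IsCAlgebraic) := by
    rcases hπ with ⟨T, hT, h⟩ | ⟨T, hT, h⟩
    exacts [⟨T, hT, Or.inl h⟩, ⟨T, hT, Or.inr h⟩]
  obtain ⟨T₃, hwf, ha, -, halg, -⟩ := InfinityType.exists_ad T hT.1
  have hT₃ : P.HasInfinityType T₃ := by
    refine ⟨hwf, ?_⟩
    have hfun : (fun σ : F →+* ℂ => (T₃ σ).map ArchWeight.a) =
        fun σ : F →+* ℂ => ((((T σ).map ArchWeight.a) ×ˢ ((T σ).map ArchWeight.a)).map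
          fun p : ℂ × ℂ => p.1 - p.2).erase 0 := funext ha
    rw [hfun]
    exact hP _ hT.2
  exact ⟨⟨T₃, hT₃, (halg hTalg).1⟩, ⟨T₃, hT₃, (halg hTalg).2⟩⟩

/-- **The adjoint lift of a regular algebraic `GL₂` representation is regular algebraic** (with
`hP` as above): regular algebraic = C-algebraic and regular (Clozel 1990, Déf. 1.8, 3.12), and both
pass to the adjoint infinity type (`InfinityType.exists_ad`). This is the case of a holomorphic newform
of weight `k ≥ 2` (`{(k-1)/2, (1-k)/2} ↦ {k - 1, 1 - k, 0}`). Clozel 1990, Déf. 3.12; Gelbart–Jacquet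
1978, Prop. 3.2. [cite: Clozel1990, Déf. 1.8 and 3.12] -/
theorem AutomorphicRepData.isRegularAlgebraic_of_hasArchParameter_ad
    (hP : ∀ χ : (F →+* ℂ) → Multiset ℂ, π.HasArchParameter χ →
      P.HasArchParameter fun σ : F →+* ℂ =>
        (((χ σ) ×ˢ (χ σ)).map fun p : ℂ × ℂ => p.1 - p.2).erase 0)
    (hπ : π.IsRegularAlgebraic) : P.IsRegularAlgebraic := by
  obtain ⟨T, hT, hTC, hTreg⟩ := hπ
  obtain ⟨T₃, hwf, ha, -, halg, hreg⟩ := InfinityType.exists_ad T hT.1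
  refine ⟨T₃, ⟨hwf, ?_⟩, (halg (Or.inr hTC)).2, hreg hTreg⟩
  have hfun : (fun σ : F →+* ℂ => (T₃ σ).map ArchWeight.a) =
      fun σ : F →+* ℂ => ((((T σ).map ArchWeight.a) ×ˢ ((T σ).map ArchWeight.a)).map
        fun p : ℂ × ℂ => p.1 - p.2).erase 0 := funext ha
  rw [hfun]
  exact hP _ hT.2

/-- **The infinity type of the lift is determined.** With `hP` as above, every infinity type `T'` of
`P` has `a`-multisets `Ad₊` of those of any infinity type `T` of `π` at every embedding (uniqueness
of archimedean parameters, `AutomorphicRepData.hasArchParameter_unique`: the infinitesimal character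
of `P_∞` determines them; Clozel 1990, §3.3). [cite: Clozel1990, §3.3] -/
theorem AutomorphicRepData.infinityType_map_a_eq_ad
    (hP : ∀ χ : (F →+* ℂ) → Multiset ℂ, π.HasArchParameter χ →
      P.HasArchParameter fun σ : F →+* ℂ =>
        (((χ σ) ×ˢ (χ σ)).map fun p : ℂ × ℂ => p.1 - p.2).erase 0)
    {T : InfinityType F 2} (hT : π.HasInfinityType T)
    {T' : InfinityType F 3} (hT' : P.HasInfinityType T') (σ : F →+* ℂ) :
    (T' σ).map ArchWeight.a =
      ((((T σ).map ArchWeight.a) ×ˢ ((T σ).map ArchWeight.a)).map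
        fun p : ℂ × ℂ => p.1 - p.2).erase 0 :=
  congr_fun (P.hasArchParameter_unique hT'.2 (hP _ hT.2)) σ

end Arch

/-! ### Projections of the fact and Thm. (9.3) at `∞` in the form in which it is used -/

/-- **The fact contains the Satake-only adjoint lift verbatim**: `GelbartJacquet_adjoint_lift`
(`LanglandsTetrahedral`; Gelbart–Jacquet 1978, Thm. (9.3) (2)–(3) with (3.5); Gelbart 1997,
Thm. 5.3.2) is its first conjunct. [cite: GelbartJacquet1978, Thm. (9.3) and (3.5)]
[cite: Gelbart1997, Thm. 5.3.2] -/
theorem GelbartJacquet_adjoint_lift_archimedean.adjoint_lift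
    (h : GelbartJacquet_adjoint_lift_archimedean) : GelbartJacquet_adjoint_lift := by
  intro F _ _ hF hF3 π hπ
  obtain ⟨P, hP, -⟩ := h F hF hF3 π hπ
  exact ⟨P, hP⟩

/-- Hence the fact also gives the symmetric-square normalisation `GelbartJacquet_symmSq_cuspidal`
(`Sym² = Ad ⊗ ω`, `GelbartJacquet_symmSq_cuspidal_of_adjoint_lift`). Gelbart–Jacquet 1978, Thm. (9.3)
with Def. 3.1.3 and (3.5). [cite: GelbartJacquet1978, Thm. (9.3), Def. 3.1.3 and (3.5)] -/
theorem GelbartJacquet_adjoint_lift_archimedean.symmSq_cuspidal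
    (h : GelbartJacquet_adjoint_lift_archimedean) : GelbartJacquet_symmSq_cuspidal :=
  GelbartJacquet_symmSq_cuspidal_of_adjoint_lift h.adjoint_lift

/-- **Thm. (9.3) at `∞` for a pair of exponents** — the form in which the fact is used: if the
cuspidal `π` on `GL₂(𝔸_F)` (no a.e. quadratic self-twist) has archimedean parameter
`σ ↦ {a σ, b σ}`, its cuspidal adjoint lift `P` on `GL₃(𝔸_F)` (with `t_{P,v} = Ad(t_{π,v})` a.e.)
has archimedean parameter `σ ↦ {a σ - b σ, b σ - a σ, 0}` (`adArch_pair`; for a holomorphic newform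
of weight `k`, `{(k-1)/2, (1-k)/2} ↦ {k - 1, 1 - k, 0}`). Gelbart–Jacquet 1978, Thm. (9.3) (2)–(3)
and Prop. 3.2, (3.2.1)–(3.2.3). [cite: GelbartJacquet1978, Thm. (9.3) (2)–(3) and Prop. 3.2] -/
theorem GelbartJacquet_adjoint_lift_archimedean.exists_lift_pair
    (h : GelbartJacquet_adjoint_lift_archimedean)
    (F : Type) [Field F] [NumberField F] (hF : isCompact_glFiniteIntegralLevel 2 F)
    (hF3 : isCompact_glFiniteIntegralLevel 3 F) (π : CuspidalAutomorphicRepData 2 F hF)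
    (hπ : ∀ (K : Type) [Field K] [NumberField K] [Algebra F K], Module.finrank F K = 2 →
      ¬ IsQuadraticSelfTwistAE K π.1)
    (a b : (F →+* ℂ) → ℂ) (hχ : π.1.HasArchParameter fun σ => {a σ, b σ}) :
    ∃ P : CuspidalAutomorphicRepData 3 F hF3,
      (∀ᶠ v : HeightOneSpectrum (𝓞 F) in Filter.cofinite, ∀ α : Multiset ℂ,
        π.1.HasSatakeParamAt v α → P.1.HasSatakeParamAt v (adParams α)) ∧
      P.1.HasArchParameter fun σ => {a σ - b σ, b σ - a σ, 0} := by
  obtain ⟨P, hP, harch⟩ := h F hF hF3 π hπ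
  refine ⟨P, hP, ?_⟩
  have hfun : (fun σ : F →+* ℂ => ({a σ - b σ, b σ - a σ, 0} : Multiset ℂ)) =
      fun σ : F →+* ℂ =>
        ((({a σ, b σ} : Multiset ℂ) ×ˢ ({a σ, b σ} : Multiset ℂ)).map
          fun p : ℂ × ℂ => p.1 - p.2).erase 0 :=
    funext fun σ => (adArch_pair (a σ) (b σ)).symm
  rw [hfun]
  exact harch _ hχ

/-- **Thm. (9.3) at `∞` for a regular algebraic `π`** — the form in which the fact is used: a
regular algebraic cuspidal `π` on `GL₂(𝔸_F)` without a.e. quadratic self-twist has a **regular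
algebraic, L-algebraic** cuspidal adjoint lift `P` on `GL₃(𝔸_F)` with `t_{P,v} = Ad(t_{π,v})` at
almost every finite `v` and the archimedean clause (`isRegularAlgebraic_of_hasArchParameter_ad`,
`isLAlgebraic_of_hasArchParameter_ad`). Gelbart–Jacquet 1978, Thm. (9.3) (2)–(3) and Prop. 3.2;
Clozel 1990, Déf. 3.12. [cite: GelbartJacquet1978, Thm. (9.3) (2)–(3) and Prop. 3.2] -/
theorem GelbartJacquet_adjoint_lift_archimedean.exists_lift_isRegularAlgebraic
    (h : GelbartJacquet_adjoint_lift_archimedean)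
    (F : Type) [Field F] [NumberField F] (hF : isCompact_glFiniteIntegralLevel 2 F)
    (hF3 : isCompact_glFiniteIntegralLevel 3 F) (π : CuspidalAutomorphicRepData 2 F hF)
    (hπ : ∀ (K : Type) [Field K] [NumberField K] [Algebra F K], Module.finrank F K = 2 →
      ¬ IsQuadraticSelfTwistAE K π.1)
    (hreg : π.1.IsRegularAlgebraic) :
    ∃ P : CuspidalAutomorphicRepData 3 F hF3,
      (∀ᶠ v : HeightOneSpectrum (𝓞 F) in Filter.cofinite, ∀ α : Multiset ℂ,
        π.1.HasSatakeParamAt v α → P.1.HasSatakeParamAt v (adParams α)) ∧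
      (∀ χ : (F →+* ℂ) → Multiset ℂ, π.1.HasArchParameter χ →
        P.1.HasArchParameter fun σ : F →+* ℂ =>
          (((χ σ) ×ˢ (χ σ)).map fun p : ℂ × ℂ => p.1 - p.2).erase 0) ∧
      P.1.IsRegularAlgebraic ∧ P.1.IsLAlgebraic := by
  obtain ⟨P, hP, harch⟩ := h F hF hF3 π hπ
  exact ⟨P, hP, harch, AutomorphicRepData.isRegularAlgebraic_of_hasArchParameter_ad harch hreg,
    (AutomorphicRepData.isLAlgebraic_of_hasArchParameter_ad harch (Or.inr hreg.isCAlgebraic)).1⟩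

/-! ### The pointwise fact `GelbartJacquet_adjoint_lift_pointwise`: Thm. (9.3) (2)–(3) with (3.5)
at EVERY finite place — projections and the forms in which it is used

`GelbartJacquet_adjoint_lift_pointwise` (same fact file) renders the SAME printed theorem with the
Satake clause at every finite place `v` at which `π` is unramified, which is how parts (2)–(3) of
Thm. (9.3) (p. 534: "*(2) for any place `v` the representation `σ_v` admits a lift `π_v` to
`G_{3,v}`; (3) set `π = ⊗ π_v` (all `v`). Then `π` is automorphic cuspidal*") together with (3.5)
(p. 490: "*Suppose `F` is non-archimedean and `σ` "quasi-unramified" … `σ` admits a lift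
`π = π(λ)` where `λ = α^{s₁-s₂} ⊕ 1 ⊕ α^{s₂-s₁}`. More precisely, `π` is the only irreducible
quotient of `ξ = Ind(G₃, B₃; α^{s₁-s₂}, 1, α^{s₂-s₁})`, and `π` contains the trivial
representation of `K₃ = GL(3, R_F)`, that is, `π` is unramified*") state it: the lift is the
restricted tensor product of the local lifts at ALL places, and the local lift of an unramified
`σ_v` with Satake parameter `t_{σ,v}` is unramified with Satake parameter `Ad(t_{σ,v})`. The
pointwise fact contains the almost-everywhere fact verbatim (`.archimedean` below, `∀ v` gives
`∀ᶠ v`), hence everything proved from that fact above, and it is the form a consumer needs at ONE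
prescribed finite place (which no `∀ᶠ v` statement can see): `.exists_twisted_lift` is Thm. (9.3)
with (3.5) for the twisted lift `Ad(π) ⊗ (χ ∘ det)` at every place at which `π` and `χ` are
unramified (Arthur–Clozel 1989, Ch. 3, proof of Thm. 3.1: `t_{P ⊗ χ, v} = χ(ϖ_v) t_{P,v}` at a
level of `χ ∘ det` prime to `v`, which exists because `χ` is unramified at `v`,
`HeckeCharacter.exists_level_not_dvd_of_isUnramifiedAt`; the twist does not move the archimedean
parameter, `AutomorphicRepData.HasArchParameter.twist`).

Status of the discharge `GelbartJacquet_adjoint_lift_pointwise_holds` (triage: XL): exactly as for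
the almost-everywhere fact (module docstring) — the pointwise fact implies it, so nothing short of
the printed proof (the local lifts of §3, the analytic theory of `L₂(s, σ, χ)` of §§4–8 and the
converse theorem for `GL₃`, (9.2)–(9.8)) produces `P`, and none of these has a carrier on the
tree; the discharge is parked on the tree's apex representative `GelbartJacquet_adjoint_lift` of
Thm. (9.3), with the almost-everywhere fact. -/

section Pointwise

/-- **`Ad` is twist-invariant on Satake parameters**: `Ad(c · β) = Ad(β)` for `c ≠ 0` — the
unramified shadow of "*if `π` is a lift of `σ`, it is also a lift of `σ ⊗ χ` for any `χ`*"
(p. 485, after Def. (3.1.3); at an unramified place `t_{σ ⊗ χ, v} = χ(ϖ_v) t_{σ,v}`), i.e. the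
unitarity normalisation remark of the facts' docstrings at the finite places.
[cite: GelbartJacquet1978, §3, after Def. (3.1.3) (p. 485)] -/
theorem adParams_map_const_mul (β : Multiset ℂ) {c : ℂ} (hc : c ≠ 0) :
    adParams (β.map (c * ·)) = adParams β := by
  simp only [adParams, map_sprod_map, Multiset.map_map, Function.comp_def, Prod.map_fst,
    Prod.map_snd]
  congr 1
  refine Multiset.map_congr rfl fun p _ => ?_
  rw [mul_inv, mul_mul_mul_comm, mul_inv_cancel₀ hc, one_mul]

/-- **The pointwise fact contains the almost-everywhere fact verbatim**
(`GelbartJacquet_adjoint_lift_archimedean`: `∀ v` gives `∀ᶠ v`), hence all of the consequences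
`GelbartJacquet_adjoint_lift_archimedean.*` above. [cite: GelbartJacquet1978, Thm. (9.3) (2)–(3), (3.5) and Prop. (3.2)] -/
theorem GelbartJacquet_adjoint_lift_pointwise.archimedean
    (h : GelbartJacquet_adjoint_lift_pointwise) : GelbartJacquet_adjoint_lift_archimedean := by
  intro F _ _ hF hF3 π hπ
  obtain ⟨P, hS, hA⟩ := h F hF hF3 π hπ
  exact ⟨P, Filter.Eventually.of_forall fun v α hα => hS v α hα, hA⟩

/-- Hence the pointwise fact contains the Satake-only fact `GelbartJacquet_adjoint_lift`
(`LanglandsTetrahedral`; Gelbart 1997, Thm. 5.3.2). [cite: GelbartJacquet1978, Thm. (9.3) (2)–(3) and (3.5)]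
[cite: Gelbart1997, Thm. 5.3.2] -/
theorem GelbartJacquet_adjoint_lift_pointwise.adjoint_lift
    (h : GelbartJacquet_adjoint_lift_pointwise) : GelbartJacquet_adjoint_lift :=
  h.archimedean.adjoint_lift

/-- Hence also the symmetric-square normalisation `GelbartJacquet_symmSq_cuspidal`.
[cite: GelbartJacquet1978, Thm. (9.3), Def. 3.1.3 and (3.5)] -/
theorem GelbartJacquet_adjoint_lift_pointwise.symmSq_cuspidal
    (h : GelbartJacquet_adjoint_lift_pointwise) : GelbartJacquet_symmSq_cuspidal :=
  h.archimedean.symmSq_cuspidal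

/-- **Thm. (9.3) with (3.5) and Prop. (3.2) for the twisted lift `Ad(π) ⊗ (χ ∘ det)`, at every
unramified place.** From the pointwise fact: for `π` cuspidal on `GL₂(𝔸_F)` without a.e. quadratic
self-twist and `χ` a Hecke character of `F` of finite order, the cuspidal lift `P` on `GL₃(𝔸_F)`
has `t_{P,v} = Ad(t_{π,v})` at every finite `v` at which `π` is unramified, its cuspidal twist
`P ⊗ (χ ∘ det)` (`CuspidalAutomorphicRepData.twist`) has Satake parameter `χ(ϖ_v) · Ad(α)` at
EVERY finite place `v` at which `χ` is unramified and `π` has Satake parameter `α` (the lift is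
unramified there with parameter `Ad(α)`, (3.5); then `t_{P ⊗ χ, v} = χ(ϖ_v) t_{P,v}` at a level of
`χ ∘ det` prime to `v`, Arthur–Clozel 1989, Ch. 3, proof of Thm. 3.1, through
`HeckeCharacter.exists_level_not_dvd_of_isUnramifiedAt` and
`AutomorphicRepData.HasSatakeParamAt.twist_of_isUnramifiedAt`), and both `P` and `P ⊗ (χ ∘ det)`
have the archimedean parameter `Ad₊` of that of `π` (Prop. (3.2); a finite-order twist does not
move it, `AutomorphicRepData.HasArchParameter.twist`).
[cite: GelbartJacquet1978, Thm. (9.3) (2)–(3), (3.5) and Prop. (3.2)]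
[cite: ArthurClozelAMS120, Ch. 3, proof of Thm. 3.1 (p. 172)] -/
theorem GelbartJacquet_adjoint_lift_pointwise.exists_twisted_lift
    (h : GelbartJacquet_adjoint_lift_pointwise)
    (F : Type) [Field F] [NumberField F] (hF : isCompact_glFiniteIntegralLevel 2 F)
    (hF3 : isCompact_glFiniteIntegralLevel 3 F) (π : CuspidalAutomorphicRepData 2 F hF)
    (hπ : ∀ (K : Type) [Field K] [NumberField K] [Algebra F K], Module.finrank F K = 2 →
      ¬ IsQuadraticSelfTwistAE K π.1)
    (χ : GaloisRepresentations.HeckeCharacter F) (hχ : χ.IsFiniteOrder) :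
    ∃ P : CuspidalAutomorphicRepData 3 F hF3,
      (∀ (v : HeightOneSpectrum (𝓞 F)) (α : Multiset ℂ), π.1.HasSatakeParamAt v α →
        P.1.HasSatakeParamAt v (adParams α)) ∧
      (∀ v : HeightOneSpectrum (𝓞 F), χ.IsUnramifiedAt v → ∀ α : Multiset ℂ,
        π.1.HasSatakeParamAt v α →
          (P.twist χ hχ).1.HasSatakeParamAt v ((adParams α).map (χ.valueAtUniformizer v * ·))) ∧
      ∀ χ' : (F →+* ℂ) → Multiset ℂ, π.1.HasArchParameter χ' →
        P.1.HasArchParameter (fun σ : F →+* ℂ =>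
          (((χ' σ) ×ˢ (χ' σ)).map fun p : ℂ × ℂ => p.1 - p.2).erase 0) ∧
        (P.twist χ hχ).1.HasArchParameter (fun σ : F →+* ℂ =>
          (((χ' σ) ×ˢ (χ' σ)).map fun p : ℂ × ℂ => p.1 - p.2).erase 0) := by
  obtain ⟨P, hS, hA⟩ := h F hF hF3 π hπ
  refine ⟨P, hS, fun v hv α hα => ?_, fun χ' hχ' => ⟨hA χ' hχ', ?_⟩⟩
  · obtain ⟨𝔪, h𝔪, hv𝔪, hχ𝔪⟩ :=
      GaloisRepresentations.HeckeCharacter.exists_level_not_dvd_of_isUnramifiedAt 3 hv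
    rw [CuspidalAutomorphicRepData.twist_val]
    exact (hS v α hα).twist_of_isUnramifiedAt hχ h𝔪 hχ𝔪 hv𝔪 hv
  · rw [CuspidalAutomorphicRepData.twist_val]
    exact AutomorphicRepData.HasArchParameter.twist (π := P.1) χ hχ (hA χ' hχ')

/-- **Thm. (9.3) at every place for a pair of exponents** — the form in which the pointwise fact is
used for a holomorphic newform: if `π` (no a.e. quadratic self-twist) has archimedean parameter
`σ ↦ {a σ, b σ}`, its cuspidal adjoint lift `P` has `t_{P,v} = Ad(t_{π,v})` at every finite place at
which `π` is unramified and archimedean parameter `σ ↦ {a σ - b σ, b σ - a σ, 0}` (`adArch_pair`; for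
weight `k`, `{(k-1)/2, (1-k)/2} ↦ {k - 1, 1 - k, 0}`). [cite: GelbartJacquet1978, Thm. (9.3) (2)–(3), (3.5) and Prop. (3.2)] -/
theorem GelbartJacquet_adjoint_lift_pointwise.exists_lift_pair
    (h : GelbartJacquet_adjoint_lift_pointwise)
    (F : Type) [Field F] [NumberField F] (hF : isCompact_glFiniteIntegralLevel 2 F)
    (hF3 : isCompact_glFiniteIntegralLevel 3 F) (π : CuspidalAutomorphicRepData 2 F hF)
    (hπ : ∀ (K : Type) [Field K] [NumberField K] [Algebra F K], Module.finrank F K = 2 →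
      ¬ IsQuadraticSelfTwistAE K π.1)
    (a b : (F →+* ℂ) → ℂ) (hχ : π.1.HasArchParameter fun σ => {a σ, b σ}) :
    ∃ P : CuspidalAutomorphicRepData 3 F hF3,
      (∀ (v : HeightOneSpectrum (𝓞 F)) (α : Multiset ℂ),
        π.1.HasSatakeParamAt v α → P.1.HasSatakeParamAt v (adParams α)) ∧
      P.1.HasArchParameter fun σ => {a σ - b σ, b σ - a σ, 0} := by
  obtain ⟨P, hP, harch⟩ := h F hF hF3 π hπ
  refine ⟨P, hP, ?_⟩
  have hfun : (fun σ : F →+* ℂ => ({a σ - b σ, b σ - a σ, 0} : Multiset ℂ)) =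
      fun σ : F →+* ℂ =>
        ((({a σ, b σ} : Multiset ℂ) ×ˢ ({a σ, b σ} : Multiset ℂ)).map
          fun p : ℂ × ℂ => p.1 - p.2).erase 0 :=
    funext fun σ => (adArch_pair (a σ) (b σ)).symm
  rw [hfun]
  exact harch _ hχ

/-- **Thm. (9.3) at every place for a regular algebraic `π`**: a regular algebraic cuspidal `π` on
`GL₂(𝔸_F)` without a.e. quadratic self-twist has a regular algebraic, L-algebraic cuspidal adjoint
lift `P` on `GL₃(𝔸_F)` with `t_{P,v} = Ad(t_{π,v})` at every finite place at which `π` is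
unramified and the archimedean clause (`isRegularAlgebraic_of_hasArchParameter_ad`,
`isLAlgebraic_of_hasArchParameter_ad`). [cite: GelbartJacquet1978, Thm. (9.3) (2)–(3), (3.5) and Prop. (3.2)]
[cite: Clozel1990, Déf. 3.12] -/
theorem GelbartJacquet_adjoint_lift_pointwise.exists_lift_isRegularAlgebraic
    (h : GelbartJacquet_adjoint_lift_pointwise)
    (F : Type) [Field F] [NumberField F] (hF : isCompact_glFiniteIntegralLevel 2 F)
    (hF3 : isCompact_glFiniteIntegralLevel 3 F) (π : CuspidalAutomorphicRepData 2 F hF)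
    (hπ : ∀ (K : Type) [Field K] [NumberField K] [Algebra F K], Module.finrank F K = 2 →
      ¬ IsQuadraticSelfTwistAE K π.1)
    (hreg : π.1.IsRegularAlgebraic) :
    ∃ P : CuspidalAutomorphicRepData 3 F hF3,
      (∀ (v : HeightOneSpectrum (𝓞 F)) (α : Multiset ℂ),
        π.1.HasSatakeParamAt v α → P.1.HasSatakeParamAt v (adParams α)) ∧
      (∀ χ : (F →+* ℂ) → Multiset ℂ, π.1.HasArchParameter χ →
        P.1.HasArchParameter fun σ : F →+* ℂ =>
          (((χ σ) ×ˢ (χ σ)).map fun p : ℂ × ℂ => p.1 - p.2).erase 0) ∧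
      P.1.IsRegularAlgebraic ∧ P.1.IsLAlgebraic := by
  obtain ⟨P, hP, harch⟩ := h F hF hF3 π hπ
  exact ⟨P, hP, harch, AutomorphicRepData.isRegularAlgebraic_of_hasArchParameter_ad harch hreg,
    (AutomorphicRepData.isLAlgebraic_of_hasArchParameter_ad harch (Or.inr hreg.isCAlgebraic)).1⟩

end Pointwise

end Literature.NumberTheory.Automorphic

end
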